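import Mathlib
import Summits.ResolutionOfSingularities.ResolutionOfSingularities.Theorems.WeightedInvariantLocalWeightedDropNCResCurveGraphClose
import Summits.ResolutionOfSingularities.ResolutionOfSingularities.Theorems.WeightedInvariantLocalWeightedDropNCResApexColumnStepsB
import Summits.ResolutionOfSingularities.ResolutionOfSingularities.Theorems.WeightedInvariantLocalWeightedDropNCResEndgameReductionB

/-!
# `WeightedInvariant.LocalWeightedDrop` ENGINE, W′|₄ line — D₃ᴮ object (10): THE APEX-COLUMN REGIME IN B-FORM, CLOSED (HAND B, 2/2) — D₃ᴮ MODULO THE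
# TANGENT ENDGAME ALONE

Sub-problem `ResolutionOfSingularities`, ENGINE crux `stmt-ResolutionOfSingularities-8899` (`LocalWeightedDrop`), registered stub W′|₄
`stub_wildWideApexFourStartsWon`; res-L1-w43-plan-1 RULING 2026-08-27T21:45:42Z (D₃ᴮ lane).  [OURS · L1 W4.3 · chain w43 · res-L1-w43-lead-1 g6; def-free;
RE-THREADS over `DBWinsTo` (p575221) of res-L1-w43-stub-1's S-E1-CURVE loop (`GraphCurve.dWinsTo_headDrop_of_graph_terminal` …NCResCurveGraphIdeal,
`dWinsTo_headDrop_of_graphCurve` …NCResCurveGraphLoop) and of the dispatch `GraphCurve.dWinsTo_headDrop_of_hCol` (…NCResCurveGraphClose): identity point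
blow-ups and one B-permissible curve move, transforms as successors — the same proofs.  Nothing here is a statement of any manuscript; AI-produced,
gate-checked, weaker than expert review.]

* `DBWinsTo.of_move` — one B-permissible move whose every answer carries a B-winning state is B-winning;
* `GraphCurve.dbWinsTo_headDrop_of_graph_terminal`, `GraphCurve.dbWinsTo_headDrop_of_graphCurve`, `GraphCurve.dbWinsTo_headDrop_of_hCol`;
* **`regimeApexColumnB`** — the hypothesis `hH` of `surfaceBoundaryNC_of_regimesB`, verbatim, UNCONDITIONAL (three letters, `k` infinite);
* **`surfaceBoundaryNC_of_tangentB`** — D₃ᴮ (a B-forced normal crossing from EVERY admissibly decorated position; three letters, `k` algebraically closed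
  of characteristic `p`) MODULO THE TANGENT ENDGAME `hT` ALONE (hand D, …NCResEndgameReductionB): regimes (H) (P) (L) (B) are all tree theorems in B-form.
-/

set_option linter.dupNamespace false -- mandated namespace of this single-conjunct summit

noncomputable section

namespace Summit.ResolutionOfSingularities.ResolutionOfSingularities.Theorems

namespace TameFourTupleDrop

open MvPowerSeries Literature.AlgebraicGeometry.Resolution

variable {k : Type} [Field k] {m : ℕ}

/-- **ONE B-PERMISSIBLE MOVE WHOSE EVERY ANSWER CARRIES A B-WINNING STATE IS B-WINNING.** -/
theorem DBWinsTo.of_move {Q : MvPowerSeries (Fin (m + 1)) k × Decoration k m → Prop} {σ : MvPowerSeries (Fin (m + 1)) k × Decoration k m}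
    (h : ∃ (Φ : Fin (m + 1) → MvPowerSeries (Fin (m + 1)) k) (w : Fin (m + 1) → ℕ),
      IsBPermissible σ.2 Φ w ∧ BMoveClause σ Φ w (fun τ' => DBWinsTo Q τ')) :
    DBWinsTo Q σ := by
  have h1 : DBWinsTo (fun τ => DBWinsTo Q τ) σ := by
    refine DBWinsTo.of_measure ({σ} : Set (MvPowerSeries (Fin (m + 1)) k × Decoration k m)) (fun _ => 0) ?_ (Set.mem_singleton σ)
    intro τ hτ _
    rw [Set.mem_singleton_iff] at hτ
    subst hτ
    obtain ⟨Φ, w, hperm, hcl⟩ := h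
    exact ⟨Φ, w, hperm, hcl.mono fun τ' hτ' => Or.inl hτ'⟩
  exact h1.bind fun τ hτ => hτ

namespace GraphCurve

/-- **THE TERMINAL MOVE B-WINS THE HEAD PHASE** (OURS · L1 W4.3; S-E1-CURVE; re-thread of `dWinsTo_headDrop_of_graph_terminal`): from an admissibly decorated position whose product `g = f·∏_O x_l` of
order `c` has apex dimension `≤ 1` and a permissible GRAPH CURVE over the letter `x_i` contained in every OTHER boundary letter plane, the curve move
`(Φ_C, 𝟙_{j ≠ i})` is B-permissible and drops the head at every answer (`m ≥ 1`). -/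
theorem dbWinsTo_headDrop_of_graph_terminal [Infinite k] {b : MvPowerSeries (Fin (m + 1)) k} {δ : Decoration k m} (hadm : Admissible b δ)
    (hm : 0 < m) {i : Fin (m + 1)} {φ : Fin (m + 1) → PowerSeries k} (hφ : ∀ j, j ≠ i → PowerSeries.constantCoeff (φ j) = 0)
    (hperm : InOffIdeal i δ.c (subst (shear i φ) (δ.f * ∏ l ∈ δ.O, X l)))
    (hterm : ∀ l ∈ δ.E, l ≠ i → φ l = 0)
    (hcol : ∀ u₁ u₂ : Fin (m + 1) → k,
      (∀ v, CobordantChart.initEval (fun _ : Fin (m + 1) => 1) (v + u₁) δ.c (δ.f * ∏ l ∈ δ.O, X l) =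
        CobordantChart.initEval (fun _ : Fin (m + 1) => 1) v δ.c (δ.f * ∏ l ∈ δ.O, X l)) →
      (∀ v, CobordantChart.initEval (fun _ : Fin (m + 1) => 1) (v + u₂) δ.c (δ.f * ∏ l ∈ δ.O, X l) =
        CobordantChart.initEval (fun _ : Fin (m + 1) => 1) v δ.c (δ.f * ∏ l ∈ δ.O, X l)) →
      ∃ α β : k, (α ≠ 0 ∨ β ≠ 0) ∧ α • u₁ + β • u₂ = 0) :
    DBWinsTo (fun τ : MvPowerSeries (Fin (m + 1)) k × Decoration k m => Admissible τ.1 τ.2 ∧ τ.2.head < δ.head) (b, δ) := by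
  -- the weights `𝟙_{j ≠ i}`: a positive weight exists since `m ≥ 1`
  obtain ⟨j₀, hj₀⟩ : ∃ j₀ : Fin (m + 1), j₀ ≠ i := by
    by_cases hi : i = 0
    · refine ⟨Fin.last m, fun h => ?_⟩
      have h1 := congrArg Fin.val (h.trans hi)
      rw [Fin.val_last, Fin.val_zero] at h1
      omega
    · exact ⟨0, fun h => hi h.symm⟩
  have hmv : IsCountMove (shear i φ) (fun j : Fin (m + 1) => if j = i then 0 else 1) :=
    isCountMove_shear hφ (fun j => by split_ifs <;> simp) ⟨j₀, by rw [if_neg hj₀]; exact Nat.one_pos⟩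
  have hB : IsBPermissible δ (shear i φ) (fun j : Fin (m + 1) => if j = i then 0 else 1) :=
    isBPermissible_of_totalO_weightedOrder hadm hmv (shear_letters_of_terminal hterm) (le_weightedOrder_of_inOffIdeal hperm)
  exact dbWinsTo_headDrop_of_apexLine_curve hadm hB (l₀ := i) (if_pos rfl) hcol

/-! ## The loop, B-form -/

/-- **FROM A PERMISSIBLE GRAPH CURVE AT APEX DIMENSION ≤ 1 THE MOVER B-FORCES A HEAD DROP** (OURS · L1 W4.3; S-E1-CURVE; re-thread of `dWinsTo_headDrop_of_graphCurve`: identity point blow-ups and the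
terminal curve move, all B-permissible, transforms as successors — the sub-regime
«`e(g) ≤ 1`, the point lies ON a permissible smooth curve», complementary to res-type-056's `TOT2E1.dWinsTo_headDrop_of_isolated`).  Strategy:
while some boundary letter other than the graph letter does not contain the curve, play the identity point move — every answer drops the head except
the tangent answer, whose successor is again such a state with strictly smaller contact potential `Σ (ord φ_l)²` — and at potential `0` play the
curve move `(Φ_C, 𝟙_{j ≠ i})`, which is then B-permissible and has no near point.  `m ≥ 1`, `k` infinite. -/
theorem dbWinsTo_headDrop_of_graphCurve [Infinite k] (hm : 0 < m) {b : MvPowerSeries (Fin (m + 1)) k} {δ : Decoration k m}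
    (hadm : Admissible b δ) {i : Fin (m + 1)} {φ : Fin (m + 1) → PowerSeries k}
    (hφ : ∀ j, j ≠ i → PowerSeries.constantCoeff (φ j) = 0)
    (hperm : InOffIdeal i δ.c (subst (shear i φ) (δ.f * ∏ l ∈ δ.O, X l)))
    (hcol : ∀ u₁ u₂ : Fin (m + 1) → k,
      (∀ v, CobordantChart.initEval (fun _ : Fin (m + 1) => 1) (v + u₁) δ.c (δ.f * ∏ l ∈ δ.O, X l) =
        CobordantChart.initEval (fun _ : Fin (m + 1) => 1) v δ.c (δ.f * ∏ l ∈ δ.O, X l)) →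
      (∀ v, CobordantChart.initEval (fun _ : Fin (m + 1) => 1) (v + u₂) δ.c (δ.f * ∏ l ∈ δ.O, X l) =
        CobordantChart.initEval (fun _ : Fin (m + 1) => 1) v δ.c (δ.f * ∏ l ∈ δ.O, X l)) →
      ∃ α β : k, (α ≠ 0 ∨ β ≠ 0) ∧ α • u₁ + β • u₂ = 0) :
    DBWinsTo (fun τ : MvPowerSeries (Fin (m + 1)) k × Decoration k m => Admissible τ.1 τ.2 ∧ τ.2.head < δ.head) (b, δ) := by
  classical
  -- strong induction on the contact potential
  suffices H : ∀ (n : ℕ) (b : MvPowerSeries (Fin (m + 1)) k) (δ : Decoration k m) (i : Fin (m + 1)) (φ : Fin (m + 1) → PowerSeries k),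
      Admissible b δ → (∀ j, j ≠ i → PowerSeries.constantCoeff (φ j) = 0) →
      InOffIdeal i δ.c (subst (shear i φ) (δ.f * ∏ l ∈ δ.O, X l)) →
      (∀ u₁ u₂ : Fin (m + 1) → k,
        (∀ v, CobordantChart.initEval (fun _ : Fin (m + 1) => 1) (v + u₁) δ.c (δ.f * ∏ l ∈ δ.O, X l) =
          CobordantChart.initEval (fun _ : Fin (m + 1) => 1) v δ.c (δ.f * ∏ l ∈ δ.O, X l)) →
        (∀ v, CobordantChart.initEval (fun _ : Fin (m + 1) => 1) (v + u₂) δ.c (δ.f * ∏ l ∈ δ.O, X l) =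
          CobordantChart.initEval (fun _ : Fin (m + 1) => 1) v δ.c (δ.f * ∏ l ∈ δ.O, X l)) →
        ∃ α β : k, (α ≠ 0 ∨ β ≠ 0) ∧ α • u₁ + β • u₂ = 0) →
      contactSq δ.E i φ = n →
      DBWinsTo (fun τ : MvPowerSeries (Fin (m + 1)) k × Decoration k m => Admissible τ.1 τ.2 ∧ τ.2.head < δ.head) (b, δ) from
    H _ b δ i φ hadm hφ hperm hcol rfl
  intro n
  induction n using Nat.strong_induction_on with
  | _ n ih =>
  intro b δ i φ hadm hφ hperm hcol hn
  by_cases hterm : ∀ l ∈ δ.E, l ≠ i → φ l = 0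
  · -- terminal: the curve move
    exact dbWinsTo_headDrop_of_graph_terminal hadm hm hφ hperm hterm hcol
  · -- the identity point move
    push Not at hterm
    have hf : δ.f ≠ 0 := hadm.2.1.ne_zero
    have hpermX := isBPermissible_point_X δ
    have hconv : ∀ (c : Fin (m + 1) → k) (l : Fin (m + 1)), (fun _ : Fin (m + 1) => (1 : ℕ)) l = 0 → c l = 0 :=
      fun _ _ h => absurd h one_ne_zero
    refine DBWinsTo.of_move ⟨fun j => (X j : MvPowerSeries (Fin (m + 1)) k), fun _ => 1, hpermX, ?_⟩
    intro c hc hc0 A G hfac hG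
    -- choose the slot: `i` if live, else any live slot
    have hslot : ∃ s : Fin (m + 1), c s ≠ 0 ∧ (c i ≠ 0 → s = i) := by
      by_cases hci : c i ≠ 0
      · exact ⟨i, hci, fun _ => rfl⟩
      · obtain ⟨s, hs⟩ : ∃ s, c s ≠ 0 := Function.ne_iff.mp hc0
        exact ⟨s, hs, fun h => absurd h hci⟩
    obtain ⟨s, hcs, hsi⟩ := hslot
    set δ' := δ.transform (fun j => (X j : MvPowerSeries (Fin (m + 1)) k)) (fun _ => 1) c s with hδ'
    have hadm' : Admissible (X 0 * TupleGame.slice s G) δ' := admissible_transform hadm hpermX (hconv c) hfac hG hcs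
    refine ⟨s, hcs, ?_⟩
    change DBWinsTo (fun τ : MvPowerSeries (Fin (m + 1)) k × Decoration k m => Admissible τ.1 τ.2 ∧ τ.2.head < δ.head)
      (X 0 * TupleGame.slice s G, δ')
    by_cases hlt : δ'.head < δ.head
    · exact DBWinsTo.of_target ⟨hadm', hlt⟩
    · -- same head: the tangent answer at the graph letter's slot
      have hhead : δ'.head = δ.head := le_antisymm (Decoration.head_transform_le hpermX (hconv c) hf hcs) (not_lt.mp hlt)
      -- the product through the chart, for the near analysis
      obtain ⟨H, U, hfacH, hH, -, -⟩ := Decoration.totalO_chart_eq hpermX (hconv c) hf hcs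
      rw [show subst (fun j => (X j : MvPowerSeries (Fin (m + 1)) k)) (δ.f * ∏ l ∈ δ.O, X l) = δ.f * ∏ l ∈ δ.O, X l from
        congrFun subst_self _] at hfacH
      obtain ⟨hc', hci⟩ := tangent_answer_of_head_eq hadm hφ hperm hcol hcs hfacH hH hhead
      have hs : s = i := hsi hci
      subst hs
      -- the successor state
      have hφ' : ∀ j, j ≠ (0 : Fin (m + 1)) → PowerSeries.constantCoeff (step s φ c j) = 0 := constantCoeff_step hc'
      have hperm' := inOffIdeal_transform hadm hφ hperm hc' hci hhead
      have hcol' := apexLine_transform_of_head_eq hadm hcol hcs hhead hadm'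
      have hE' : δ'.E = insert 0 (Decoration.newLetters δ.E (fun j => (X j : MvPowerSeries (Fin (m + 1)) k)) c s) :=
        Decoration.transform_E _ _ _ _ _
      have hlt' : contactSq δ'.E 0 (step s φ c) < n := by
        rw [hE', ← hn]
        exact contactSq_step_lt hφ hc' hci hterm
      have hwin := ih _ hlt' (X 0 * TupleGame.slice s G) δ' 0 (step s φ c) hadm' hφ' hperm' hcol' rfl
      rw [hhead] at hwin
      exact hwin

/-! ## The dispatch, B-form -/

/-- **THE REGIME «APEX DIMENSION ≤ 1» IS B-WON** (OURS · L1 W4.3; re-thread of `dWinsTo_headDrop_of_hCol`; TOT2-LINE inner dispatch, regime `HCol`): from every admissibly decorated position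
with `o ≥ 2` whose product `g = f·∏_{l∈O} x_l` (order `c = o + |O|`) has at most a line of invariance vectors in its degree-`c` form, the mover
forces an admissibly decorated position of strictly smaller head `(o, c)`.  Three sub-regimes: no invariance vector (E0: the identity point move has
no near point — part 12); a line of them and NO permissible smooth curve (res-type-056's S-E1: prepared axis presentations, the fundamental
sequence is finite); a line of them and SOME permissible smooth curve (res-type-056's entry lemma re-presents it as a graph curve; part 17's loop:
finitely many identity point moves lower the contact potential with the boundary letters, then the curve move has no near point). -/
theorem dbWinsTo_headDrop_of_hCol [Infinite k] (hm : 0 < m) {b : MvPowerSeries (Fin (m + 1)) k} {δ : Decoration k m}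
    (hadm : Admissible b δ) (ho : 2 ≤ δ.o)
    (hcol : ∀ u₁ u₂ : Fin (m + 1) → k,
      (∀ v, CobordantChart.initEval (fun _ : Fin (m + 1) => 1) (v + u₁) δ.c (δ.f * ∏ l ∈ δ.O, X l) =
        CobordantChart.initEval (fun _ : Fin (m + 1) => 1) v δ.c (δ.f * ∏ l ∈ δ.O, X l)) →
      (∀ v, CobordantChart.initEval (fun _ : Fin (m + 1) => 1) (v + u₂) δ.c (δ.f * ∏ l ∈ δ.O, X l) =
        CobordantChart.initEval (fun _ : Fin (m + 1) => 1) v δ.c (δ.f * ∏ l ∈ δ.O, X l)) →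
      ∃ α β : k, (α ≠ 0 ∨ β ≠ 0) ∧ α • u₁ + β • u₂ = 0) :
    DBWinsTo (fun τ : MvPowerSeries (Fin (m + 1)) k × Decoration k m => Admissible τ.1 τ.2 ∧ τ.2.head < δ.head) (b, δ) := by
  by_cases hapex : ∀ u : Fin (m + 1) → k,
      (∀ v, CobordantChart.initEval (fun _ : Fin (m + 1) => 1) (v + u) δ.c (δ.f * ∏ l ∈ δ.O, X l) =
        CobordantChart.initEval (fun _ : Fin (m + 1) => 1) v δ.c (δ.f * ∏ l ∈ δ.O, X l)) → u = 0
  · -- E0: no invariance vector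
    exact dbWinsTo_headDrop_of_apexTrivial hadm hapex
  · push Not at hapex
    obtain ⟨v₀, hv₀, hv₀ne⟩ := hapex
    have hone : ∃ v : Fin (m + 1) → k, v ≠ 0 ∧ ∀ x : Fin (m + 1) → k,
        CobordantChart.initEval (fun _ : Fin (m + 1) => 1) (x + v) δ.c (δ.f * ∏ l ∈ δ.O, X l) =
          CobordantChart.initEval (fun _ : Fin (m + 1) => 1) x δ.c (δ.f * ∏ l ∈ δ.O, X l) := ⟨v₀, hv₀ne, hv₀⟩
    by_cases hisol : ∀ Φ : Fin (m + 1) → MvPowerSeries (Fin (m + 1)) k, (∀ l, constantCoeff (Φ l) = 0) →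
        IsUnit (Matrix.det (Matrix.of fun a j : Fin (m + 1) => coeff (Finsupp.single j 1) (Φ a))) →
        ¬ AxisPolyhedron.InAxisIdeal δ.c (subst Φ (δ.f * ∏ l ∈ δ.O, X l))
    · -- S-E1: isolated (res-type-056)
      exact TOT2E1.dbWinsTo_headDrop_of_isolated hadm ho hone hcol hisol
    · -- S-E1-CURVE: on a permissible curve
      push Not at hisol
      obtain ⟨Φ, hΦ0, hΦdet, hin⟩ := hisol
      obtain ⟨i, φ, hφ0, -, hperm⟩ := exists_shear_inOffIdeal_of_legal_inAxisIdeal hΦ0 hΦdet hin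
      exact dbWinsTo_headDrop_of_graphCurve hm hadm (fun j _ => hφ0 j) hperm hcol
end GraphCurve

/-- **REGIME (H) «APEX COLUMN» IN B-PERMISSIBLE FORM** — the hypothesis `hH` of `surfaceBoundaryNC_of_regimesB`, verbatim, UNCONDITIONAL (three letters,
`k` infinite). -/
theorem regimeApexColumnB [Infinite k] :
    ∀ (b : MvPowerSeries (Fin (2 + 1)) k) (δ : Decoration k 2), Admissible b δ → 2 ≤ δ.o → δ.HCol →
      DBWinsTo (fun τ => Admissible τ.1 τ.2 ∧ τ.2.head < δ.head) (b, δ) :=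
  fun _ _ hadm ho hcol => GraphCurve.dbWinsTo_headDrop_of_hCol Nat.two_pos hadm ho hcol

/-- **D₃ᴮ MODULO THE TANGENT ENDGAME ALONE** (three letters, `k` algebraically closed of characteristic `p`): regimes (H) `regimeApexColumnB`, (P)
`regimePresentedB`, (L) `regimeLetterB`, (B) `regimeBadB` and the endgame's normal-crossing exits are tree theorems in B-form; from EVERY admissibly
decorated position the mover B-forces a normal crossing as soon as the tangent case `hT` of the `o = 1` endgame is supplied (hand D,
`…NCResEndgameReductionB`). -/
theorem surfaceBoundaryNC_of_tangentB (p : ℕ) [Fact p.Prime] [CharP k p] [IsAlgClosed k]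
    (hT : ∀ (b : MvPowerSeries (Fin (2 + 1)) k) (δ : Decoration k 2), Admissible b δ → δ.o = 1 →
      (∀ j, j ∉ δ.E → coeff (Finsupp.single j 1) δ.f = 0) →
      DBWinsTo (fun τ => GermIsNC τ.1 ∨ (Admissible τ.1 τ.2 ∧ τ.2.head < δ.head)) (b, δ))
    (b : MvPowerSeries (Fin (2 + 1)) k) (δ : Decoration k 2) (hadm : Admissible b δ) :
    DBWinsTo (fun τ : MvPowerSeries (Fin (2 + 1)) k × Decoration k 2 => GermIsNC τ.1) (b, δ) := by
  haveI : Infinite k := IsAlgClosed.instInfinite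
  exact surfaceBoundaryNC_of_apexColumnB_of_tangentB p regimeApexColumnB hT b δ hadm

end TameFourTupleDrop

end Summit.ResolutionOfSingularities.ResolutionOfSingularities.Theorems

end
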